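import Mathlib.NumberTheory.Multiplicity
import Mathlib.NumberTheory.Padics.RingHoms
import Mathlib.RingTheory.RootsOfUnity.PrimitiveRoots
import Mathlib.Algebra.CharP.Lemmas
import HarnessLib

/-!
# Sinnott's independence of power functions on `μ_{M^∞}` over a field of characteristic `p ≠ M`

Topic `Literature/NumberTheory/LFunctions`; namespace `Literature.NumberTheory.LFunctions.Sinnott1987`.
THEOREMS ONLY (one auxiliary `def`, the Frobenius trace operator; no named facts).

This is §2 of W. Sinnott, *On a theorem of L. Washington*, Astérisque 147–148 (1987), 209–224
(the algebraic proof of Washington's theorem on the non-`p`-part of the class number in the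
cyclotomic `ℤ_M`-tower), in finite terms.  Fix two distinct primes: `p`, the characteristic of
the field `F`, and `M`, the "tower" prime.  For a power `q` of `p` with `M ∣ q - 1`
(`4 ∣ q - 1` when `M = 2`) put `M^{n₀} ∥ q - 1`; then `μ_{M^∞}(𝔽_q) = μ_{M^{n₀}}`.

* `frobTrace q L x = ∑_{i<L} x^{q^i}` — the trace-like operator `∑ Frob_q^i` (additive, and
  `𝔽_q`-linear: `frobTrace_mul_of_pow_eq`).
* `padicValNat_pow_pow_sub_one` — lifting the exponent: `v_M(q^{M^j} - 1) = n₀ + j`.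
* `frobTrace_eq_zero_of_isPrimitiveRoot` — **Sinnott's (3.5)/(2.2) key computation**: for a
  primitive `M^s`-th root of unity `ζ` with `s > n₀` and `n ≥ s - n₀`,
  `∑_{i<M^n} ζ^{q^i} = 0`; and `frobTrace_eq_of_pow_eq` — `= M^n ζ` when `ζ ∈ 𝔽_q`.
* `eq_zero_of_infinite_zeros` — **Sinnott, Thm. 2.2 (independence of power functions)**: if
  `b₁, …, b_r ∈ 𝔽_q` and `a₁, …, a_r ∈ ℤ_M` are distinct, and `∑ bᵢ ζ^{aᵢ} = 0` for a primitive
  `M^s`-th root of unity `ζ` with `s` large (explicitly: `s ≥ n₀ + N₁` where the `aᵢ` are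
  pairwise distinct modulo `M^{N₁}`), then all `bᵢ = 0`.  Here `ζ^a` for `a ∈ ℤ_M` is
  `ζ^{a mod M^s}` (`torsionPow`).

Proof of Thm. 2.2 as printed (p. 213): multiply the relation by `ζ^{-a_j}` and apply the trace
from `𝔽_q(ζ)` to `𝔽_q`; a `M`-power root of unity outside `𝔽_q` has trace `0` (its Frobenius
orbit is a union of cosets of the subgroup of order `M`, whose sum vanishes), one inside has trace
`[𝔽_q(ζ):𝔽_q] · itself`, and `[𝔽_q(ζ):𝔽_q]` is a power of `M`, invertible in `F`.  We replace
the field-theoretic trace by the explicit operator `frobTrace` (no subfields are needed).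

## References

* W. Sinnott, *On a theorem of L. Washington*, Astérisque 147–148 (1987), 209–224, §2
  (Thm. 2.2, Cor. 2.4) and (3.5). [Sinnott1987]
* L. C. Washington, *The non-`p`-part of the class number in a cyclotomic `ℤ_p`-extension*,
  Invent. Math. 49 (1978), 87–97. [Washington1978]
-/

noncomputable section

open Finset

namespace Literature.NumberTheory.LFunctions.Sinnott1987

variable {F : Type*} [Field F]

/-! ### The Frobenius trace operator -/

section FrobTrace

/-- The operator `T_{q,L}(x) = ∑_{i<L} x^{q^i}` (for `q` a power of the characteristic this is
`∑_{i<L} Frob_q^i`, the trace from `𝔽_{q^L}` to `𝔽_q` on `𝔽_{q^L}`). [cite: Sinnott1987, (3.5)] -/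
def frobTrace (q L : ℕ) (x : F) : F :=
  ∑ i ∈ range L, x ^ q ^ i

/-- Unfolding `frobTrace`. [folklore] -/
theorem frobTrace_def (q L : ℕ) (x : F) : frobTrace q L x = ∑ i ∈ range L, x ^ q ^ i := rfl

variable {p : ℕ} [Fact p.Prime] [CharP F p]

/-- Additivity: `T(x + y) = T x + T y` when `q = p^d`. [folklore] -/
theorem frobTrace_add {q d : ℕ} (hq : q = p ^ d) (L : ℕ) (x y : F) :
    frobTrace q L (x + y) = frobTrace q L x + frobTrace q L y := by
  simp only [frobTrace, ← sum_add_distrib]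
  refine sum_congr rfl fun i _ ↦ ?_
  rw [hq, ← pow_mul]
  exact add_pow_char_pow x y p (d * i)

omit [Fact p.Prime] [CharP F p] in
/-- `T(0) = 0` (for `q ≠ 0`). [folklore] -/
theorem frobTrace_zero {q : ℕ} (hq : q ≠ 0) (L : ℕ) : frobTrace q L (0 : F) = 0 := by
  simp only [frobTrace]
  exact sum_eq_zero fun i _ ↦ zero_pow (pow_ne_zero _ hq)

/-- `T(∑ f) = ∑ T(f)`. [folklore] -/
theorem frobTrace_sum {q d : ℕ} (hq : q = p ^ d) (L : ℕ) {ι : Type*} (s : Finset ι)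
    (f : ι → F) : frobTrace q L (∑ j ∈ s, f j) = ∑ j ∈ s, frobTrace q L (f j) := by
  classical
  have hq0 : q ≠ 0 := by rw [hq]; exact pow_ne_zero _ (Fact.out : p.Prime).ne_zero
  induction s using Finset.induction_on with
  | empty => simp [frobTrace_zero hq0]
  | insert a s ha ih => rw [sum_insert ha, sum_insert ha, frobTrace_add hq, ih]

omit [Fact p.Prime] [CharP F p] in
/-- `𝔽_q`-linearity: `T(b x) = b T(x)` when `b^q = b`. [folklore] -/
theorem pow_pow_eq_self_of_pow_eq {q : ℕ} {b : F} (hb : b ^ q = b) (i : ℕ) : b ^ q ^ i = b := by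
  induction i with
  | zero => simp
  | succ i ih => rw [pow_succ, pow_mul, ih, hb]

omit [Fact p.Prime] [CharP F p] in
/-- `𝔽_q`-linearity: `T(b x) = b T(x)` when `b^q = b`. [folklore] -/
theorem frobTrace_mul_of_pow_eq {q : ℕ} (L : ℕ) {b : F} (hb : b ^ q = b) (x : F) :
    frobTrace q L (b * x) = b * frobTrace q L x := by
  simp only [frobTrace, mul_sum, mul_pow]
  refine sum_congr rfl fun i _ ↦ ?_
  rw [pow_pow_eq_self_of_pow_eq hb]

omit [Fact p.Prime] [CharP F p] in
/-- An element of `𝔽_q` (`x^q = x`) has `T(x) = L · x`. [cite: Sinnott1987, (3.5)] -/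
theorem frobTrace_eq_of_pow_eq {q : ℕ} (L : ℕ) {x : F} (hx : x ^ q = x) :
    frobTrace q L x = L * x := by
  have : frobTrace q L (x * 1) = x * frobTrace q L 1 := frobTrace_mul_of_pow_eq L hx 1
  rw [mul_one] at this
  rw [this, frobTrace]
  simp [mul_comm]

end FrobTrace

/-! ### Lifting the exponent in the `M`-adic tower -/

section LTE

variable {M : ℕ} [hM : Fact M.Prime]

/-- The standing hypothesis on `q`: `M ∣ q - 1`, and `4 ∣ q - 1` when `M = 2`, `1 < q`
(so that `μ_M ⊂ 𝔽_q`, resp. `μ_4 ⊂ 𝔽_q`, and `1 + M^{n₀}ℤ_M` is pro-cyclic generated by `q`).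
[cite: Sinnott1987, §3, proof of Thm. 3.2 ("we may suppose that μ_p ⊂ k (resp. μ_4 ⊂ k if p = 2)")] -/
structure GoodModulus (M q : ℕ) : Prop where
  one_lt : 1 < q
  dvd : M ∣ q - 1
  four_dvd : M = 2 → 4 ∣ q - 1

/-- `M ∤ q`. [folklore] -/
theorem GoodModulus.not_dvd {q : ℕ} (hq : GoodModulus M q) : ¬ M ∣ q := by
  intro h
  have h1 : M ∣ q - (q - 1) := Nat.dvd_sub h hq.dvd
  rw [Nat.sub_sub_self hq.one_lt.le] at h1
  exact hM.out.one_lt.ne' (Nat.dvd_one.mp h1)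

/-- `v_M(q - 1) ≥ 1` (`≥ 2` when `M = 2`). [folklore] -/
theorem GoodModulus.one_le_padicValNat {q : ℕ} (hq : GoodModulus M q) :
    1 ≤ padicValNat M (q - 1) := by
  have h0 : q - 1 ≠ 0 := by have := hq.one_lt; omega
  exact (padicValNat_dvd_iff_le (p := M) (n := 1) h0).mp (by rw [pow_one]; exact hq.dvd)

/-- **Lifting the exponent**: `v_M(q^{M^j} - 1) = v_M(q - 1) + j`. [folklore] -/
theorem padicValNat_pow_pow_sub_one {q : ℕ} (hq : GoodModulus M q) (j : ℕ) :
    padicValNat M (q ^ M ^ j - 1) = padicValNat M (q - 1) + j := by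
  have hMp := hM.out
  have hq1 : 1 < q := hq.one_lt
  have hMq : ¬ M ∣ q := hq.not_dvd
  rcases hMp.eq_two_or_odd' with h2 | hodd
  · subst h2
    rcases Nat.eq_zero_or_pos j with rfl | hj
    · simp
    have h4 : 4 ∣ q - 1 := hq.four_dvd rfl
    have hne : (2 : ℕ) ^ j ≠ 0 := pow_ne_zero _ two_ne_zero
    have heven : Even (2 ^ j) := (Nat.even_pow' hj.ne').mpr (by decide)
    have h := padicValNat.pow_two_sub_one hq1 hMq hne heven
    -- `v₂(q + 1) = 1` since `q ≡ 1 (mod 4)`.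
    have hq1' : padicValNat 2 (q + 1) = 1 := by
      obtain ⟨c, hc⟩ := h4
      have hq' : q + 1 = 2 * (2 * c + 1) := by omega
      rw [hq', padicValNat.mul (by norm_num) (by omega), padicValNat.self (by norm_num),
        padicValNat.eq_zero_of_not_dvd (by omega)]
    rw [padicValNat.prime_pow] at h
    omega
  · rcases Nat.eq_zero_or_pos j with rfl | hj
    · simp
    have hne : M ^ j ≠ 0 := pow_ne_zero _ hMp.ne_zero
    have h := padicValNat.pow_sub_pow (p := M) hodd hq1 (by simpa using hq.dvd)
      hMq hne
    simpa [padicValNat.prime_pow] using h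

/-- `M^s ∣ q^{M^j} - 1` as soon as `v_M(q-1) + j ≥ s`. [folklore] -/
theorem pow_dvd_pow_pow_sub_one {q : ℕ} (hq : GoodModulus M q) {s j : ℕ}
    (h : s ≤ padicValNat M (q - 1) + j) : M ^ s ∣ q ^ M ^ j - 1 := by
  have hpos : 0 < q ^ M ^ j - 1 := by
    have : 1 < q ^ M ^ j := Nat.one_lt_pow (pow_ne_zero _ hM.out.ne_zero) hq.one_lt
    omega
  rw [padicValNat_dvd_iff_le hpos.ne', padicValNat_pow_pow_sub_one hq]
  exact h

/-- The element `g = q^{M^{s-n₀-1}}` (`n₀ = v_M(q-1) < s`): `g = 1 + M^{s-1} u` with `M ∤ u`.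
[cite: Sinnott1987, proof of Thm. 2.2] -/
theorem exists_pow_pow_eq_one_add {q : ℕ} (hq : GoodModulus M q) {s : ℕ}
    (hs : padicValNat M (q - 1) < s) :
    ∃ u : ℕ, ¬ M ∣ u ∧ q ^ M ^ (s - padicValNat M (q - 1) - 1) = 1 + M ^ (s - 1) * u := by
  set n₀ := padicValNat M (q - 1)
  set g := q ^ M ^ (s - n₀ - 1) with hg
  have hg1 : 1 < g := Nat.one_lt_pow (pow_ne_zero _ hM.out.ne_zero) hq.one_lt
  have hv : padicValNat M (g - 1) = s - 1 := by
    rw [hg, padicValNat_pow_pow_sub_one hq]; omega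
  have hpos : g - 1 ≠ 0 := by omega
  obtain ⟨u, hu⟩ : M ^ (s - 1) ∣ g - 1 := by
    rw [padicValNat_dvd_iff_le hpos, hv]
  refine ⟨u, fun hMu ↦ ?_, by omega⟩
  have : M ^ (s - 1 + 1) ∣ g - 1 := by
    rw [hu, pow_succ]; exact Nat.mul_dvd_mul_left _ hMu
  rw [padicValNat_dvd_iff_le hpos, hv] at this
  omega

end LTE

/-! ### The trace of an `M`-power root of unity -/

section Trace

variable {M : ℕ} [hM : Fact M.Prime] {p : ℕ} [Fact p.Prime] [CharP F p]

omit [Fact p.Prime] [CharP F p] in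
/-- Powers of a root of unity only depend on the exponent modulo the order. [folklore] -/
theorem pow_eq_pow_of_modEq {ζ : F} {n a b : ℕ} (hζ : ζ ^ n = 1) (h : a ≡ b [MOD n]) :
    ζ ^ a = ζ ^ b := by
  rw [pow_eq_pow_mod a hζ, pow_eq_pow_mod b hζ, h]

omit [Fact p.Prime] [CharP F p] in
/-- A sum over `range L` of an `L`-periodic function is invariant under shifts. [folklore] -/
theorem sum_range_shift_of_periodic {β : Type*} [AddCancelCommMonoid β] {f : ℕ → β} {L : ℕ}
    (hf : ∀ i, f (i + L) = f i) (c : ℕ) :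
    ∑ i ∈ range L, f (i + c) = ∑ i ∈ range L, f i := by
  induction c with
  | zero => simp
  | succ c ih =>
    rw [← ih]
    have h1 : ∑ i ∈ range (L + 1), f (i + c) = (∑ i ∈ range L, f (i + c)) + f (L + c) :=
      sum_range_succ _ _
    have h2 : ∑ i ∈ range (L + 1), f (i + c) = (∑ i ∈ range L, f (i + 1 + c)) + f (0 + c) :=
      sum_range_succ' _ _
    have h3 : f (L + c) = f (0 + c) := by rw [zero_add, add_comm, hf]
    have : (∑ i ∈ range L, f (i + 1 + c)) = ∑ i ∈ range L, f (i + (c + 1)) :=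
      sum_congr rfl fun i _ ↦ by rw [add_assoc, Nat.add_comm 1 c]
    rw [← this]
    exact add_right_cancel (b := f (L + c)) (by rw [← h1, h2, h3])

/-- **The trace of a root of unity outside `𝔽_q` vanishes** (Sinnott's (3.5), second case): for
a primitive `M^s`-th root of unity `ζ` with `s > n₀ = v_M(q-1)` and `n ≥ s - n₀`,
`∑_{i<M^n} ζ^{q^i} = 0`.  Proof: with `g = q^{M^{s-n₀-1}} = 1 + M^{s-1}u`, `M ∤ u`, the sum `S`
is invariant under `i ↦ i + t M^{s-n₀-1}`, and `∑_{t<M} ζ^{q^i g^t} = ζ^{q^i} ∑_t ω^{q^i u t} = 0`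
(`ω = ζ^{M^{s-1}}` a primitive `M`-th root of unity), so `M · S = 0`. [cite: Sinnott1987, (3.5)] -/
theorem frobTrace_eq_zero_of_isPrimitiveRoot (hMp : M ≠ p) {q : ℕ} (hq : GoodModulus M q)
    {s n : ℕ} (hs : padicValNat M (q - 1) < s) (hn : s ≤ padicValNat M (q - 1) + n) {ζ : F}
    (hζ : IsPrimitiveRoot ζ (M ^ s)) : frobTrace q (M ^ n) ζ = 0 := by
  have hMp' := hM.out
  have hMq : ¬ M ∣ q := hq.not_dvd
  have hn₀1 : 1 ≤ padicValNat M (q - 1) := hq.one_le_padicValNat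
  set n₀ := padicValNat M (q - 1) with hn₀
  obtain ⟨u, hMu, hg⟩ := exists_pow_pow_eq_one_add hq hs
  set P := M ^ (s - n₀ - 1) with hP
  set g := q ^ P with hgdef
  have hζ1 : ζ ^ M ^ s = 1 := hζ.pow_eq_one
  -- the summand and its periodicity
  set f : ℕ → F := fun i ↦ ζ ^ q ^ i with hf
  have hper : ∀ i, f (i + M ^ n) = f i := by
    intro i
    simp only [hf, pow_add, pow_mul]
    have hd : M ^ s ∣ q ^ M ^ n - 1 := pow_dvd_pow_pow_sub_one hq hn
    have h1 : 1 ≤ q ^ M ^ n := Nat.one_le_pow _ _ (by linarith [hq.one_lt])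
    have : (ζ ^ q ^ i) ^ q ^ M ^ n = (ζ ^ q ^ i) ^ 1 := by
      refine pow_eq_pow_of_modEq (by rw [← pow_mul, mul_comm, pow_mul, hζ1, one_pow]) ?_
      exact (Nat.modEq_iff_dvd' h1).mpr hd |>.symm
    rw [this, pow_one]
  -- `M • S = ∑_t ∑_i f (i + t P)`
  have hS : (M : F) * frobTrace q (M ^ n) ζ = ∑ t ∈ range M, ∑ i ∈ range (M ^ n), f (i + t * P) := by
    rw [frobTrace]
    have : ∀ t ∈ range M, ∑ i ∈ range (M ^ n), f (i + t * P) = ∑ i ∈ range (M ^ n), f i :=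
      fun t _ ↦ sum_range_shift_of_periodic hper _
    rw [sum_congr rfl this, sum_const, card_range, nsmul_eq_mul]
  -- `ω = ζ^{M^{s-1}}` is a primitive `M`-th root of unity
  have hs1 : s - 1 + 1 = s := by omega
  have hω : IsPrimitiveRoot (ζ ^ M ^ (s - 1)) M := by
    have := hζ.pow_of_dvd (p := M ^ (s - 1)) (pow_ne_zero _ hMp'.ne_zero)
      (pow_dvd_pow M (by omega))
    rwa [show M ^ s / M ^ (s - 1) = M by
      rw [← hs1, pow_succ, hs1, Nat.mul_div_cancel_left _ (pow_pos hMp'.pos _)]] at this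
  -- `f (i + t P) = ζ^{q^i} ω^{q^i u t}`
  have hft : ∀ i t, f (i + t * P) = ζ ^ q ^ i * (ζ ^ M ^ (s - 1)) ^ (q ^ i * u * t) := by
    intro i t
    simp only [hf]
    rw [← pow_mul, ← pow_add]
    refine pow_eq_pow_of_modEq hζ1 ?_
    rw [pow_add, mul_comm t P, pow_mul, ← hgdef, hg]
    -- `q^i (1 + M^{s-1} u)^t ≡ q^i (1 + t M^{s-1} u) (mod M^s)`
    have key : (1 + M ^ (s - 1) * u) ^ t ≡ 1 + M ^ (s - 1) * u * t [MOD M ^ s] := by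
      induction t with
      | zero => simp [Nat.ModEq.refl]
      | succ t ih =>
        rw [pow_succ]
        calc (1 + M ^ (s - 1) * u) ^ t * (1 + M ^ (s - 1) * u)
            ≡ (1 + M ^ (s - 1) * u * t) * (1 + M ^ (s - 1) * u) [MOD M ^ s] := ih.mul_right _
          _ = 1 + M ^ (s - 1) * u * (t + 1) + M ^ (s - 1) * M ^ (s - 1) * (u * u * t) := by ring
          _ ≡ 1 + M ^ (s - 1) * u * (t + 1) + 0 [MOD M ^ s] := by
            refine Nat.ModEq.add_left _ ?_
            rw [Nat.modEq_zero_iff_dvd, ← pow_add]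
            exact Dvd.dvd.mul_right (pow_dvd_pow M (by omega)) _
          _ = 1 + M ^ (s - 1) * u * (t + 1) := by rw [add_zero]
    calc q ^ i * (1 + M ^ (s - 1) * u) ^ t ≡ q ^ i * (1 + M ^ (s - 1) * u * t) [MOD M ^ s] :=
          key.mul_left _
      _ = q ^ i + M ^ (s - 1) * (q ^ i * u * t) := by ring
  -- inner sums vanish
  have hinner : ∀ i, ∑ t ∈ range M, f (i + t * P) = 0 := by
    intro i
    simp_rw [hft i, ← mul_sum]
    have hprim : IsPrimitiveRoot ((ζ ^ M ^ (s - 1)) ^ (q ^ i * u)) M := by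
      refine hω.pow_of_coprime _ ?_
      refine Nat.Coprime.mul_left ?_ ?_
      · exact Nat.Coprime.pow_left _ ((Nat.Prime.coprime_iff_not_dvd hMp').mpr hMq).symm
      · exact ((Nat.Prime.coprime_iff_not_dvd hMp').mpr hMu).symm
    have : ∑ t ∈ range M, (ζ ^ M ^ (s - 1)) ^ (q ^ i * u * t) =
        ∑ t ∈ range M, ((ζ ^ M ^ (s - 1)) ^ (q ^ i * u)) ^ t :=
      sum_congr rfl fun t _ ↦ pow_mul _ _ _
    rw [this, hprim.geom_sum_eq_zero hMp'.one_lt, mul_zero]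
  have hM0 : (M : F) ≠ 0 := by
    intro h
    have := (CharP.cast_eq_zero_iff F p M).mp h
    exact hMp ((Nat.prime_dvd_prime_iff_eq (Fact.out) hMp').mp this).symm
  have : (M : F) * frobTrace q (M ^ n) ζ = 0 := by
    rw [hS, sum_comm]
    exact sum_eq_zero fun i _ ↦ hinner i
  exact (mul_eq_zero.mp this).resolve_left hM0

/-- **The trace of a root of unity inside `𝔽_q`** (Sinnott's (3.5), first case): for `ζ` with
`ζ^{M^s} = 1`, `s ≤ n₀`: `∑_{i<L} ζ^{q^i} = L ζ`. [cite: Sinnott1987, (3.5)] -/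
theorem frobTrace_eq_of_pow_pow_eq_one {q : ℕ} (hq : GoodModulus M q) {s : ℕ}
    (hs : s ≤ padicValNat M (q - 1)) {ζ : F} (hζ : ζ ^ M ^ s = 1) (L : ℕ) :
    frobTrace q L ζ = L * ζ := by
  refine frobTrace_eq_of_pow_eq L ?_
  have h0 : q - 1 ≠ 0 := by have := hq.one_lt; omega
  obtain ⟨c, hc⟩ : M ^ s ∣ q - 1 := (padicValNat_dvd_iff_le h0).mpr hs
  have hq' : q = M ^ s * c + 1 := by have := hq.one_lt; omega
  rw [hq', pow_succ, pow_mul, hζ, one_pow, one_mul]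

end Trace

/-! ### Power functions `ζ ↦ ζ^a`, `a ∈ ℤ_M`, and Sinnott's Theorem 2.2 -/

section PowerFunctions

variable {M : ℕ} [hM : Fact M.Prime]

/-- `ζ^a` for an `M`-adic integer `a` and `ζ` with `ζ^{M^s} = 1`: `ζ^{a mod M^s}`.
[cite: Sinnott1987, §2.1] -/
def torsionPow (s : ℕ) (ζ : F) (a : ℤ_[M]) : F :=
  ζ ^ (PadicInt.toZModPow s a).val

/-- Unfolding `torsionPow`. [folklore] -/
theorem torsionPow_def (s : ℕ) (ζ : F) (a : ℤ_[M]) :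
    torsionPow s ζ a = ζ ^ (PadicInt.toZModPow s a).val := rfl

/-- `ζ^{x.val} ζ^{y.val} = ζ^{(x+y).val}` for `ζ^{M^s} = 1`. [folklore] -/
theorem pow_val_mul_pow_val {s : ℕ} {ζ : F} (hζ : ζ ^ M ^ s = 1) (x y : ZMod (M ^ s)) :
    ζ ^ x.val * ζ ^ y.val = ζ ^ (x + y).val := by
  rw [← pow_add]
  refine pow_eq_pow_of_modEq hζ ?_
  rw [ZMod.val_add]
  exact (Nat.mod_modEq _ _).symm

/-- `ζ^{a} ζ^{b} = ζ^{a+b}`. [cite: Sinnott1987, §2.1] -/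
theorem torsionPow_add {s : ℕ} {ζ : F} (hζ : ζ ^ M ^ s = 1) (a b : ℤ_[M]) :
    torsionPow s ζ a * torsionPow s ζ b = torsionPow s ζ (a + b) := by
  simp only [torsionPow, map_add]
  exact pow_val_mul_pow_val hζ _ _

/-- `ζ^0 = 1`. [folklore] -/
@[simp] theorem torsionPow_zero (s : ℕ) (ζ : F) : torsionPow s ζ (0 : ℤ_[M]) = 1 := by
  simp [torsionPow]

/-- `torsionPow` does not depend on the level: if `ζ^{M^s} = 1` and `s ≤ s'` then
`ζ^{a mod M^{s'}} = ζ^{a mod M^s}`. [folklore] -/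
theorem torsionPow_eq_of_le {s s' : ℕ} (h : s ≤ s') {ζ : F} (hζ : ζ ^ M ^ s = 1) (a : ℤ_[M]) :
    torsionPow s' ζ a = torsionPow s ζ a := by
  simp only [torsionPow]
  refine pow_eq_pow_of_modEq hζ ?_
  have hc : (ZMod.cast (PadicInt.toZModPow s' a) : ZMod (M ^ s)) = PadicInt.toZModPow s a :=
    PadicInt.cast_toZModPow s s' h a
  have : ((PadicInt.toZModPow s' a).val : ZMod (M ^ s)) = ((PadicInt.toZModPow s a).val :
      ZMod (M ^ s)) := by
    rw [ZMod.natCast_val, ZMod.natCast_zmod_val, hc]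
  exact (ZMod.natCast_eq_natCast_iff _ _ _).mp this

variable {p : ℕ} [Fact p.Prime] [CharP F p]

/-- An exponent not divisible by `M^N` gives a root of unity of order `> M^{s-N}`: for a
primitive `M^s`-th root of unity `ζ` and `e ≠ 0` with `M^N ∤ e`, `ζ^e` is a primitive
`M^{s'}`-th root of unity for some `s'` with `s < s' + N`. [folklore] -/
theorem exists_isPrimitiveRoot_pow {s : ℕ} {ζ : F} (hζ : IsPrimitiveRoot ζ (M ^ s)) {e N : ℕ}
    (he : e ≠ 0) (hN : ¬ M ^ N ∣ e) :
    ∃ s', s < s' + N ∧ s' ≤ s ∧ IsPrimitiveRoot (ζ ^ e) (M ^ s') := by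
  have hMp := hM.out
  set v := padicValNat M e with hv
  have hvN : v < N := by
    by_contra h
    exact hN (dvd_trans (pow_dvd_pow M (not_lt.mp h)) pow_padicValNat_dvd)
  obtain ⟨w, hw⟩ : M ^ v ∣ e := pow_padicValNat_dvd
  have hMw : ¬ M ∣ w := by
    intro hMw
    have : M ^ (v + 1) ∣ e := by rw [hw, pow_succ]; exact Nat.mul_dvd_mul_left _ hMw
    exact pow_succ_padicValNat_not_dvd he this
  rcases le_or_gt v s with hvs | hvs
  · refine ⟨s - v, by omega, by omega, ?_⟩
    have h1 : IsPrimitiveRoot (ζ ^ w) (M ^ s) :=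
      hζ.pow_of_coprime w (Nat.Coprime.pow_right _ ((hMp.coprime_iff_not_dvd).mpr hMw).symm)
    have h2 := h1.pow_of_dvd (p := M ^ v) (pow_ne_zero _ hMp.ne_zero) (pow_dvd_pow M hvs)
    rw [Nat.pow_div hvs hMp.pos] at h2
    rwa [hw, mul_comm, pow_mul]
  · -- `M^s ∣ e`, so `ζ^e = 1`, of order `M^0`.
    refine ⟨0, by omega, by omega, ?_⟩
    have : ζ ^ e = 1 := by
      rw [hζ.pow_eq_one_iff_dvd]
      exact dvd_trans (pow_dvd_pow M hvs.le) ⟨w, hw⟩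
    rw [this, pow_zero]
    exact IsPrimitiveRoot.one

/-- **Sinnott, Thm. 2.2 (independence of the power functions `ζ ↦ ζ^a`, `a ∈ ℤ_M`)**, effective
form.  Let `q` be a power of `p` with `M ∣ q - 1` (`4 ∣ q - 1` if `M = 2`), `n₀ = v_M(q - 1)`.
Let `aᵢ ∈ ℤ_M` (`i ∈ S`) be pairwise distinct modulo `M^{N₁}` and `bᵢ ∈ 𝔽_q` (`bᵢ^q = bᵢ`).
If `∑_{i∈S} bᵢ ζ^{aᵢ} = 0` for a primitive `M^s`-th root of unity `ζ` with `s ≥ n₀ + N₁`, then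
all `bᵢ = 0`.  (Printed: "`f(z) = ∑ bᵢ z^{aᵢ}` has only finitely many zeros in `μ_{M^∞}`"; all
zeros have order `< M^{n₀+N₁}`.)  Proof as printed: multiply by `ζ^{-a_j}` and apply the trace
`∑_{i<M^{s-n₀}} Frob_q^i`, which kills `ζ^{aᵢ-a_j}` for `i ≠ j` (order `> M^{n₀}`,
`frobTrace_eq_zero_of_isPrimitiveRoot`) and multiplies `b_j` by `M^{s-n₀} ≠ 0`.
[cite: Sinnott1987, Thm. 2.2] -/
theorem eq_zero_of_sum_mul_torsionPow_eq_zero (hMp : M ≠ p) {q d : ℕ} (hqd : q = p ^ d)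
    (hq : GoodModulus M q) {ι : Type*} {S : Finset ι} {a : ι → ℤ_[M]} {b : ι → F}
    (hb : ∀ i ∈ S, b i ^ q = b i) {N₁ : ℕ}
    (ha : ∀ i ∈ S, ∀ j ∈ S, i ≠ j → PadicInt.toZModPow N₁ (a i) ≠ PadicInt.toZModPow N₁ (a j))
    {s : ℕ} (hs : padicValNat M (q - 1) + N₁ ≤ s) {ζ : F} (hζ : IsPrimitiveRoot ζ (M ^ s))
    (hsum : ∑ i ∈ S, b i * torsionPow s ζ (a i) = 0) : ∀ i ∈ S, b i = 0 := by
  classical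
  have hMp' := hM.out
  set n₀ := padicValNat M (q - 1) with hn₀
  have hζ1 : ζ ^ M ^ s = 1 := hζ.pow_eq_one
  have hM0 : (M : F) ≠ 0 := by
    intro h
    have := (CharP.cast_eq_zero_iff F p M).mp h
    exact hMp ((Nat.prime_dvd_prime_iff_eq (Fact.out) hMp').mp this).symm
  intro j hj
  -- multiply by `ζ^{-a_j}` and apply the trace
  have h1 : ∑ i ∈ S, b i * torsionPow s ζ (a i - a j) = 0 := by
    have : (∑ i ∈ S, b i * torsionPow s ζ (a i)) * torsionPow s ζ (-a j) = 0 := by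
      rw [hsum, zero_mul]
    rw [sum_mul] at this
    rw [← this]
    refine sum_congr rfl fun i _ ↦ ?_
    rw [mul_assoc, torsionPow_add hζ1, sub_eq_add_neg]
  have h2 : frobTrace q (M ^ (s - n₀)) (∑ i ∈ S, b i * torsionPow s ζ (a i - a j)) = 0 := by
    rw [h1, frobTrace_zero (by rw [hqd]; exact pow_ne_zero _ (Fact.out : p.Prime).ne_zero)]
  rw [frobTrace_sum hqd] at h2
  -- each term with `i ≠ j` vanishes
  have h3 : ∀ i ∈ S, i ≠ j →
      frobTrace q (M ^ (s - n₀)) (b i * torsionPow s ζ (a i - a j)) = 0 := by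
    intro i hi hij
    rw [frobTrace_mul_of_pow_eq _ (hb i hi)]
    set e := PadicInt.toZModPow s (a i - a j) with he
    have he0 : e.val ≠ 0 := by
      intro h0
      have : e = 0 := (ZMod.val_eq_zero e).mp h0
      apply ha i hi j hj hij
      have hN₁s : N₁ ≤ s := by omega
      have := congrArg (ZMod.cast : ZMod (M ^ s) → ZMod (M ^ N₁)) this
      rw [he, PadicInt.cast_toZModPow N₁ s hN₁s, map_sub, ZMod.cast_zero, sub_eq_zero] at this
      exact this
    have hNe : ¬ M ^ N₁ ∣ e.val := by
      intro hdvd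
      apply ha i hi j hj hij
      have hN₁s : N₁ ≤ s := by omega
      have hc : (ZMod.cast e : ZMod (M ^ N₁)) = PadicInt.toZModPow N₁ (a i - a j) :=
        PadicInt.cast_toZModPow N₁ s hN₁s _
      rw [map_sub, ZMod.cast_eq_val, (ZMod.natCast_eq_zero_iff _ _).mpr hdvd] at hc
      exact (sub_eq_zero.mp hc.symm)
    obtain ⟨s', hs'1, hs'2, hprim⟩ := exists_isPrimitiveRoot_pow hζ he0 hNe
    have : frobTrace q (M ^ (s - n₀)) (torsionPow s ζ (a i - a j)) = 0 := by
      rw [torsionPow_def, ← he]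
      exact frobTrace_eq_zero_of_isPrimitiveRoot hMp hq (by omega) (by omega) hprim
    rw [this, mul_zero]
  rw [sum_eq_single_of_mem j hj (fun i hi hij ↦ h3 i hi hij)] at h2
  -- the term `i = j` is `M^{s-n₀} b_j`
  rw [sub_self, torsionPow_zero, mul_one, frobTrace_eq_of_pow_eq _ (hb j hj), mul_eq_zero] at h2
  refine h2.resolve_left ?_
  rw [Nat.cast_pow]
  exact pow_ne_zero _ hM0

/-- Finitely many `M`-adic integers are separated at some finite level `M^{N₁}`. [folklore] -/
theorem exists_level_separating {ι : Type*} (S : Finset ι) (a : ι → ℤ_[M])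
    (ha : Set.InjOn a S) :
    ∃ N₁, ∀ i ∈ S, ∀ j ∈ S, i ≠ j →
      PadicInt.toZModPow N₁ (a i) ≠ PadicInt.toZModPow N₁ (a j) := by
  classical
  -- for each pair a separating level
  have hpair : ∀ i ∈ S, ∀ j ∈ S, i ≠ j → ∃ N, ∀ N', N ≤ N' →
      PadicInt.toZModPow N' (a i) ≠ PadicInt.toZModPow N' (a j) := by
    intro i hi j hj hij
    have hne : a i ≠ a j := fun h ↦ hij (ha hi hj h)
    obtain ⟨N, hN⟩ : ∃ N, PadicInt.toZModPow N (a i) ≠ PadicInt.toZModPow N (a j) := by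
      by_contra h
      push Not at h
      exact hne (PadicInt.ext_of_toZModPow.mp h)
    refine ⟨N, fun N' hNN' h' ↦ hN ?_⟩
    have := congrArg (ZMod.cast : ZMod (M ^ N') → ZMod (M ^ N)) h'
    rwa [PadicInt.cast_toZModPow N N' hNN', PadicInt.cast_toZModPow N N' hNN'] at this
  choose! Nf hNf using hpair
  refine ⟨S.sup fun i ↦ S.sup fun j ↦ Nf i j, fun i hi j hj hij ↦ ?_⟩
  refine hNf i hi j hj hij _ ?_
  exact le_trans (Finset.le_sup (f := fun j ↦ Nf i j) hj)
    (Finset.le_sup (f := fun i ↦ S.sup fun j ↦ Nf i j) hi)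

/-- **Sinnott, Thm. 2.2, qualitative form**: with `aᵢ` pairwise distinct and `bᵢ ∈ 𝔽_q`, there
is `s₀` such that `∑ bᵢ ζ^{aᵢ} = 0` at a primitive `M^s`-th root of unity with `s ≥ s₀` forces
all `bᵢ = 0` — "`∑ bᵢ z^{aᵢ}` has only finitely many zeros on `μ_{M^∞}`".
[cite: Sinnott1987, Thm. 2.2] -/
theorem exists_level_eq_zero_of_sum_mul_torsionPow_eq_zero (hMp : M ≠ p) {q d : ℕ}
    (hqd : q = p ^ d) (hq : GoodModulus M q) {ι : Type*} (S : Finset ι) (a : ι → ℤ_[M])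
    (ha : Set.InjOn a S) :
    ∃ s₀, ∀ (b : ι → F), (∀ i ∈ S, b i ^ q = b i) → ∀ s, s₀ ≤ s → ∀ ζ : F,
      IsPrimitiveRoot ζ (M ^ s) → ∑ i ∈ S, b i * torsionPow s ζ (a i) = 0 → ∀ i ∈ S, b i = 0 := by
  obtain ⟨N₁, hN₁⟩ := exists_level_separating S a ha
  exact ⟨padicValNat M (q - 1) + N₁, fun b hb s hs ζ hζ hsum ↦
    eq_zero_of_sum_mul_torsionPow_eq_zero hMp hqd hq hb hN₁ hs hζ hsum⟩

end PowerFunctions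

end Literature.NumberTheory.LFunctions.Sinnott1987
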